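import Summits.ABC.ABC.Theses.PadicPrimesYuNinety
import Summits.ABC.StewartYu.PrincipalUnitLatticeArith
import Literature.Barriers.ABC.BakerMethodBoundsStewartTijdemanGenericProofs
import HarnessLib

set_option linter.dupNamespace false

/-!
# Route PadicPrimesYuNinety, crux `YuNinetyThreeModFour`: the TRANSFER stub (engine ⇒ crux)

`Summits/ABC/ABC/Theorems/PadicPrimesYuNinetyThreeModFourTransfer.lean` — cell `abc-stewartyu`, seat p1.
The birth skeleton of crux stmt-ABC-19249 (line `engine-Q-twist`, planner g3) has two stubs:
`stub_engine : EngineThreeModFour` (XL, Yu 1990 §2 for `K = ℚ`, `p ≡ 3 (mod 4)`) and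
`stub_transfer : EngineThreeModFour → YuNinetyThreeModFour` (M, bookkeeping). This file proves the
transfer with the engine statement taken as an explicit hypothesis `hE` (its body, verbatim), so the
lead's `stub_transfer` is `fun h => padicPrimesYuNinety_threeModFour_of_engine h` once
`EngineThreeModFour` is an importable decl; it also CONFIRMS that the planner's engine clothing
(PRODUCT shape `C(m) · p · ∏ (Vⱼ/log p) · W · (log Vmax + log p)/(log p)²`, `C(m) ≤ c₁^m m^m`) is
strong enough for the crux text (with `c₅ = 5 c₁`).

Bookkeeping: enumerate `S` (`m = #S ≥ 1`), `αⱼ = qⱼ`, `bⱼ = e(qⱼ)`, `Vⱼ = log p · log (max 4 qⱼ)`,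
`Vmax = log p · log (max 4 (sup S))`, `W = log B`; distinct primes are `p`-adic units (`q ≠ p`),
multiplicatively independent (`StewartTijdemanGeneric.prime_family_zpow_eq_one`), and no signed
product over a non-empty `T` is a square in `ℚ` (`ord_{q_{j₀}} = 1` is odd; `−∏ < 0`); then
`(log Vmax + log p)/(log p)² ≤ 5 · log log (max 4 (sup S))` (`log log p ≤ log p − 1`,
`(2L−1)/L² ≤ 1`, `log log 4 ≥ 0.27 ≥ 1/4`), `5 c₁^m m^m ≤ (5c₁ m)^m` and `p < p²`.
Everything is [folklore].
-/

noncomputable section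

open Finset Real Height

namespace Summit.ABC.ABC.Theorems

/-- No product of DISTINCT primes over a non-empty index set is a square in `ℚ`, nor is its negative
(`ord_{q_{j₀}}(∏_{j∈T} qⱼ) = 1` is odd for `j₀ ∈ T`; `−∏ qⱼ < 0 ≤ r²`). [folklore] -/
theorem not_isSquare_prod_distinct_primes {m : ℕ} (q : Fin m → ℕ) (hq : ∀ i, (q i).Prime)
    (hinj : Function.Injective q) (T : Finset (Fin m)) (hT : T.Nonempty) :
    ¬ IsSquare (∏ j ∈ T, (q j : ℚ)) ∧ ¬ IsSquare (-∏ j ∈ T, (q j : ℚ)) := by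
  classical
  obtain ⟨j₀, hj₀⟩ := hT
  have hq0 : ∀ k, (q k : ℚ) ≠ 0 := fun k => by exact_mod_cast (hq k).ne_zero
  have hpos : 0 < ∏ j ∈ T, (q j : ℚ) := Finset.prod_pos fun j _ => by exact_mod_cast (hq j).pos
  haveI : Fact (q j₀).Prime := ⟨hq j₀⟩
  have hval : padicValRat (q j₀) (∏ j ∈ T, (q j : ℚ)) = 1 := by
    rw [Summit.ABC.StewartYu.PrincipalLattice.padicValRat_finset_prod _ _ fun k _ => hq0 k,
      Finset.sum_eq_single j₀]
    · rw [padicValRat.of_nat, padicValNat_self]; simp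
    · intro k _ hk
      haveI : Fact (q k).Prime := ⟨hq k⟩
      rw [padicValRat.of_nat, padicValNat_primes (fun h => hk (hinj h).symm)]; simp
    · intro h; exact absurd hj₀ h
  refine ⟨?_, ?_⟩
  · rintro ⟨r, hr⟩
    have hr0 : r ≠ 0 := by
      rintro rfl
      rw [mul_zero] at hr
      exact hpos.ne' hr
    have h2 : padicValRat (q j₀) (∏ j ∈ T, (q j : ℚ)) =
        padicValRat (q j₀) r + padicValRat (q j₀) r := by
      rw [hr, padicValRat.mul hr0 hr0]
    rw [hval] at h2
    omega
  · rintro ⟨r, hr⟩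
    have : (0 : ℚ) ≤ r * r := mul_self_nonneg r
    linarith

/-- `log (max 4 n) ≥ 1.38` and `log log (max 4 n) ≥ 0.27`. [folklore] -/
theorem loglog_max_four_bounds (n : ℕ) :
    (1.38 : ℝ) ≤ Real.log ((max 4 n : ℕ) : ℝ) ∧
      (0.27 : ℝ) ≤ Real.log (Real.log ((max 4 n : ℕ) : ℝ)) := by
  have h4 : (4 : ℝ) ≤ ((max 4 n : ℕ) : ℝ) := by exact_mod_cast le_max_left 4 n
  have hlog4 : (1.38 : ℝ) ≤ Real.log ((max 4 n : ℕ) : ℝ) := by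
    have h2 : (1.38 : ℝ) ≤ Real.log 4 := by
      have := Real.log_two_gt_d9
      have h : Real.log 4 = 2 * Real.log 2 := by
        rw [show (4 : ℝ) = 2 ^ 2 by norm_num, Real.log_pow]; norm_num
      linarith
    exact h2.trans (Real.log_le_log (by norm_num) h4)
  refine ⟨hlog4, ?_⟩
  have hpos : 0 < Real.log ((max 4 n : ℕ) : ℝ) := by linarith
  have := Real.one_sub_inv_le_log_of_pos hpos
  have hinv : (Real.log ((max 4 n : ℕ) : ℝ))⁻¹ ≤ 1 / 1.38 := by
    rw [one_div]; exact inv_anti₀ (by norm_num) hlog4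
  linarith [show (1 : ℝ) - 1 / 1.38 ≥ 0.27 by norm_num]

/-- **Transfer `EngineThreeModFour ⇒ YuNinetyThreeModFour`** (the M-sized stub of the birth skeleton of
crux stmt-ABC-19249, with the engine statement as the explicit hypothesis `hE`, verbatim): an engine
bound `ord_p(∏ αⱼ^{bⱼ} − 1) ≤ C(m)·p·∏(Vⱼ/log p)·W·(log Vmax + log p)/(log p)²` (`C(m) ≤ c₁^m m^m`) for
`p`-adic units of `ℚ` at `p ≡ 3 (mod 4)` gives the crux text with `c₅ = 5c₁`:
`ord_p(∏_{q∈S} q^{e_q} − 1) < (c₅ #S)^{#S} · p² · log B · log log (max 4 (sup S)) · ∏ log (max 4 q)`.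
[folklore] -/
theorem padicPrimesYuNinety_threeModFour_of_engine
    (hE : ∃ (C : ℕ → ℝ) (c₁ : ℝ), 1 ≤ c₁ ∧ (∀ m, 0 ≤ C m ∧ C m ≤ c₁ ^ m * (m : ℝ) ^ m) ∧
      ∀ (p : ℕ), p.Prime → p % 4 = 3 → ∀ (m : ℕ) (α : Fin m → ℚ) (b : Fin m → ℤ) (V : Fin m → ℝ)
        (Vmax W : ℝ),
        (∀ j, α j ≠ 0 ∧ padicValRat p (α j) = 0) →
        (∀ μ : Fin m → ℤ, ∏ j, α j ^ μ j = 1 → μ = 0) →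
        (∀ T : Finset (Fin m), T.Nonempty → ¬ IsSquare (∏ j ∈ T, α j) ∧ ¬ IsSquare (-∏ j ∈ T, α j)) →
        (∀ j, Height.logHeight₁ (α j) ≤ V j) → (∀ j, Real.log p ≤ V j) → (∀ j, V j ≤ Vmax) →
        b ≠ 0 → (∀ j, Real.log (max 3 (|b j| : ℝ)) ≤ W) →
        (padicValRat p (∏ j, α j ^ b j - 1) : ℝ) ≤
          C m * p * (∏ j, V j / Real.log p) * W * (Real.log Vmax + Real.log p) / Real.log p ^ 2) :
    Summit.ABC.ABC.Theses.PadicPrimesYuNinety.YuNinetyThreeModFour := by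
  classical
  obtain ⟨C, c₁, hc₁, hC, hA⟩ := hE
  refine ⟨5 * c₁, ?_⟩
  intro p hp hp4 S hS hpS hSne e B hB heB hne1
  haveI := Fact.mk hp
  -- enumeration of `S`
  set m : ℕ := S.card with hm
  have hm1 : 1 ≤ m := Finset.card_pos.mpr hSne
  set φ : Fin m ≃ S := S.equivFin.symm with hφ
  set q : Fin m → ℕ := fun i => (φ i : ℕ) with hqdef
  have hqS : ∀ i, q i ∈ S := fun i => (φ i).2
  have hqP : ∀ i, (q i).Prime := fun i => hS _ (hqS i)
  have hinj : Function.Injective q := fun i j hij => φ.injective (Subtype.ext hij)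
  have hqp : ∀ i, q i ≠ p := fun i h => hpS (h ▸ hqS i)
  have hreidx : ∀ {M : Type} [CommMonoid M] (f : ℕ → M), ∏ i, f (q i) = ∏ x ∈ S, f x := by
    intro M _ f
    rw [← Finset.prod_coe_sort S f]
    exact Fintype.prod_equiv φ (fun i => f (q i)) (fun x => f x) (fun i => rfl)
  -- the data fed to the engine
  set L : ℝ := Real.log p with hL
  set M4 : ℝ := ((max 4 (S.sup id) : ℕ) : ℝ) with hM4
  set X : ℝ := Real.log M4 with hX
  set α : Fin m → ℚ := fun j => (q j : ℚ) with hα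
  set b : Fin m → ℤ := fun j => e (q j) with hb
  set V : Fin m → ℝ := fun j => L * Real.log ((max 4 (q j) : ℕ) : ℝ) with hV
  set Vmax : ℝ := L * X with hVmax
  set W : ℝ := Real.log B with hW
  -- numerics of `p ≥ 3`
  have hp3 : 3 ≤ p := by have := hp.two_le; omega
  have hp3R : (3 : ℝ) ≤ p := by exact_mod_cast hp3
  have hpR0 : (0 : ℝ) < p := by linarith
  have hL1 : 1 < L := by
    have h3 : (1 : ℝ) < Real.log 3 := by
      rw [Real.lt_log_iff_exp_lt (by norm_num)]
      exact Real.exp_one_lt_d9.trans (by norm_num)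
    exact h3.trans_le (Real.log_le_log (by norm_num) hp3R)
  have hL0 : 0 < L := by linarith
  have hX1 : (1.38 : ℝ) ≤ X := (loglog_max_four_bounds (S.sup id)).1
  have hℓ : (0.27 : ℝ) ≤ Real.log X := (loglog_max_four_bounds (S.sup id)).2
  have hX0 : 0 < X := by linarith
  have hlogmax : ∀ j, (1.38 : ℝ) ≤ Real.log ((max 4 (q j) : ℕ) : ℝ) := fun j =>
    (loglog_max_four_bounds (q j)).1
  -- the engine's hypotheses
  have h1 : ∀ j, α j ≠ 0 ∧ padicValRat p (α j) = 0 := fun j =>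
    ⟨by simp only [hα]; exact_mod_cast (hqP j).ne_zero,
      Literature.Barriers.ABC.StewartTijdemanGeneric.padicValRat_natCast_prime_of_ne hp (hqP j) (hqp j)⟩
  have h2 : ∀ μ : Fin m → ℤ, ∏ j, α j ^ μ j = 1 → μ = 0 := fun μ hμ =>
    Literature.Barriers.ABC.StewartTijdemanGeneric.prime_family_zpow_eq_one hqP hinj hμ
  have h3 : ∀ T : Finset (Fin m), T.Nonempty →
      ¬ IsSquare (∏ j ∈ T, α j) ∧ ¬ IsSquare (-∏ j ∈ T, α j) := fun T hT =>
    not_isSquare_prod_distinct_primes q hqP hinj T hT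
  have h4 : ∀ j, logHeight₁ (α j) ≤ V j := by
    intro j
    haveI : NeZero (q j) := ⟨(hqP j).ne_zero⟩
    have hh : logHeight₁ (α j) = Real.log (q j) := by
      simp only [hα]; exact Rat.logHeight₁_natCast (q j)
    rw [hh]
    have hq4 : Real.log (q j) ≤ Real.log ((max 4 (q j) : ℕ) : ℝ) :=
      Real.log_le_log (by exact_mod_cast (hqP j).pos) (by exact_mod_cast le_max_right 4 (q j))
    calc Real.log (q j) ≤ Real.log ((max 4 (q j) : ℕ) : ℝ) := hq4
      _ ≤ L * Real.log ((max 4 (q j) : ℕ) : ℝ) :=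
          le_mul_of_one_le_left (by linarith [hlogmax j]) hL1.le
  have h5 : ∀ j, Real.log p ≤ V j := fun j => by
    show L ≤ L * Real.log ((max 4 (q j) : ℕ) : ℝ)
    exact le_mul_of_one_le_right hL0.le (by linarith [hlogmax j])
  have h6 : ∀ j, V j ≤ Vmax := by
    intro j
    have hle : ((max 4 (q j) : ℕ) : ℝ) ≤ M4 := by
      rw [hM4]
      exact_mod_cast max_le_max le_rfl (Finset.le_sup (f := id) (hqS j))
    have hpos : (0 : ℝ) < ((max 4 (q j) : ℕ) : ℝ) := by
      exact_mod_cast lt_of_lt_of_le (by norm_num) (le_max_left 4 (q j))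
    exact mul_le_mul_of_nonneg_left (Real.log_le_log hpos hle) hL0.le
  have hprodQ : ∏ j, α j ^ b j = ∏ x ∈ S, (x : ℚ) ^ e x := hreidx (fun x => (x : ℚ) ^ e x)
  have h7 : b ≠ 0 := by
    intro h0
    apply hne1
    rw [← hprodQ]
    exact Finset.prod_eq_one fun j _ => by rw [show b j = 0 from congrFun h0 j, zpow_zero]
  have hB0 : 0 < Real.log B := Real.log_pos (by linarith)
  have h8 : ∀ j, Real.log (max 3 (|b j| : ℝ)) ≤ W := by
    intro j
    have hle : max 3 (|b j| : ℝ) ≤ B := max_le hB (by simp only [hb]; exact heB _ (hqS j))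
    exact Real.log_le_log (lt_of_lt_of_le (by norm_num) (le_max_left _ _)) hle
  -- the engine
  have key := hA p hp hp4 m α b V Vmax W h1 h2 h3 h4 h5 h6 h7 h8
  rw [hprodQ] at key
  -- `∏ Vⱼ / log p = ∏_{q ∈ S} log (max 4 q)`
  set PL : ℝ := ∏ x ∈ S, Real.log ((max 4 x : ℕ) : ℝ) with hPL
  have hPV : ∏ j, V j / Real.log p = PL := by
    rw [hPL, ← hreidx (fun x => Real.log ((max 4 x : ℕ) : ℝ))]
    refine Finset.prod_congr rfl fun j _ => ?_
    simp only [hV]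
    rw [← hL]
    field_simp
  have hPL0 : 0 < PL := Finset.prod_pos fun x _ => by
    linarith [(loglog_max_four_bounds x).1]
  have hW0 : 0 < W := Real.log_pos (by linarith)
  have hlX0 : 0 < Real.log X := by linarith
  -- the garbage `(log Vmax + log p)/(log p)² ≤ 5 log X`
  have hgarb : (Real.log Vmax + Real.log p) / Real.log p ^ 2 ≤ 5 * Real.log X := by
    rw [← hL, hVmax, Real.log_mul hL0.ne' hX0.ne']
    have hlogL : Real.log L ≤ L - 1 := Real.log_le_sub_one_of_pos hL0
    rw [div_le_iff₀ (by positivity)]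
    have hL21 : (0 : ℝ) ≤ L ^ 2 - 1 := by nlinarith
    nlinarith [sq_nonneg (L - 1), mul_nonneg hlX0.le hL21]
  -- assemble
  set v : ℝ := (padicValRat p (∏ x ∈ S, (x : ℚ) ^ e x - 1) : ℝ) with hv
  have hCm := hC m
  have hrest0 : 0 ≤ (p : ℝ) * PL * W * (5 * Real.log X) :=
    mul_nonneg (mul_nonneg (mul_nonneg hpR0.le hPL0.le) hW0.le) (by linarith)
  have hstep1 : v ≤ C m * p * PL * W * (5 * Real.log X) := by
    have h0 : 0 ≤ C m * p * PL * W :=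
      mul_nonneg (mul_nonneg (mul_nonneg hCm.1 hpR0.le) hPL0.le) hW0.le
    calc v ≤ C m * p * (∏ j, V j / Real.log p) * W * (Real.log Vmax + Real.log p) /
          Real.log p ^ 2 := key
      _ = C m * p * PL * W * ((Real.log Vmax + Real.log p) / Real.log p ^ 2) := by
          rw [hPV, mul_div_assoc]
      _ ≤ C m * p * PL * W * (5 * Real.log X) := mul_le_mul_of_nonneg_left hgarb h0
  have hA0 : 0 < W * Real.log X * PL := mul_pos (mul_pos hW0 hlX0) hPL0
  have henv : 5 * (c₁ ^ m * (m : ℝ) ^ m) ≤ (5 * c₁ * m) ^ m := by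
    rw [mul_pow, mul_pow]
    have h5 : (5 : ℝ) ≤ 5 ^ m := by
      calc (5 : ℝ) = 5 ^ 1 := (pow_one _).symm
        _ ≤ 5 ^ m := pow_le_pow_right₀ (by norm_num) hm1
    have hc0 : 0 ≤ c₁ ^ m * (m : ℝ) ^ m := by positivity
    calc 5 * (c₁ ^ m * (m : ℝ) ^ m) ≤ 5 ^ m * (c₁ ^ m * (m : ℝ) ^ m) :=
          mul_le_mul_of_nonneg_right h5 hc0
      _ = 5 ^ m * c₁ ^ m * (m : ℝ) ^ m := by ring
  have hpp : (p : ℝ) < (p : ℝ) ^ 2 := by nlinarith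
  have hpos : 0 < (5 * c₁ * (m : ℝ)) ^ m := by positivity
  calc v ≤ C m * p * PL * W * (5 * Real.log X) := hstep1
    _ ≤ (c₁ ^ m * (m : ℝ) ^ m) * p * PL * W * (5 * Real.log X) := by
        calc C m * p * PL * W * (5 * Real.log X) = C m * (p * PL * W * (5 * Real.log X)) := by ring
          _ ≤ (c₁ ^ m * (m : ℝ) ^ m) * (p * PL * W * (5 * Real.log X)) :=
              mul_le_mul_of_nonneg_right hCm.2 hrest0
          _ = _ := by ring
    _ = (5 * (c₁ ^ m * (m : ℝ) ^ m)) * p * (W * Real.log X * PL) := by ring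
    _ ≤ (5 * c₁ * m) ^ m * p * (W * Real.log X * PL) :=
        mul_le_mul_of_nonneg_right (mul_le_mul_of_nonneg_right henv hpR0.le) hA0.le
    _ = ((5 * c₁ * m) ^ m * (W * Real.log X * PL)) * p := by ring
    _ < ((5 * c₁ * m) ^ m * (W * Real.log X * PL)) * (p : ℝ) ^ 2 :=
        mul_lt_mul_of_pos_left hpp (mul_pos hpos hA0)
    _ = (5 * c₁ * m) ^ m * (p : ℝ) ^ 2 * W * Real.log X * PL := by ring

end Summit.ABC.ABC.Theorems

end
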